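import Summits.NavierStokesRegularity.NavierStokesRegularity.Theorems.AdaptedKernelExists.Negative.GalileanCalibration

/-!
# Crux `AdaptedKernelExists` (stmt-NavierStokesRegularity-2956), line `nash-entropy-last-block`:
  a NON-TRIVIAL joint instance of the existence stub `stub_cauchyKernel` (refuter unit test)

Negative-lane helper file (`--supports stmt-NavierStokesRegularity-2956`; small-model facts, no Theses
decl is asserted).  The registered stub `stub_cauchyKernel` of the picked line asks: for `ν > 0`,
`tb < tₘ < T` and a jointly smooth, divergence-free, BOUNDED drift `b` on `Ico tb T × ℝ³` vanishing on
`[T₁, T)` for some `T₁ ∈ (tₘ, T)`, there is an adapted backward kernel of `∂ₜ + b·∇ − νΔ` on `Ico tₘ T`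
with pole `(T, x₀)` having a Gaussian envelope on `Ioo tₘ T`.

Here the whole **cut-off uniform family** is run through it: the drift `b(t, x) = a(t) e` with
`a = −D′`, `D(t) = D₀ · smoothTransition ((s₂ − t)/(s₂ − s₁))` (`D = D₀` for `t ≤ s₁`, `D = 0` for
`t ≥ s₂`, `s₁ < s₂ < T`), satisfies EVERY hypothesis of the stub (`cutoffUniform_cauchyStub_hypotheses`:
smooth, divergence-free, bounded, vanishing on `[T₁, T)`), and the stub's CONCLUSION holds for it with
the explicit kernel `Γ(t, x) = G_{ν(T−t)}(x − x₀ + D(t) e)` of the landed module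
`…Negative.UniformDriftKernel` (`cutoffUniform_cauchyStub_conclusion`: adapted on `Ico tₘ T`, envelope
`K = (4πν)^{-3/2} e^{D₀²‖e‖²/(4ν(T−s₂))}`, `a = 8ν` on `Ioo tₘ T`).  So the stub is unit-tested beyond
`b ≡ 0` on a family with non-zero displacement `D₀ e` of the pole, and its two "convenience" hypotheses
(vanishing near `T`; smoothness on a larger slab `tb < tₘ`) are seen to be jointly satisfiable with all
the others by non-trivial drifts (refuter finding: neither is load-bearing for the TRUTH of the stub —
they make the pole regular and the slab two-sided — recorded on the crux item).
-/

noncomputable section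

open MeasureTheory Set Function Filter Topology
open scoped InnerProductSpace RealInnerProductSpace ContDiff
open Literature.Analysis.FluidPDE Literature.Analysis
open Summit.NavierStokesRegularity.NavierStokesRegularity.Theorems.AdaptedKernelExistsNegative.UniformDrift
open Summit.NavierStokesRegularity.NavierStokesRegularity.Theorems.AdaptedKernelExistsNegative.Galilean
  (norm_add_sq_le_two_mul)

namespace Summit.NavierStokesRegularity.NavierStokesRegularity.Theorems.AdaptedKernelExistsNegative.CutoffUniform

/-- Local notation for physical space `ℝ³ = EuclideanSpace ℝ (Fin 3)`. -/
local notation "ℝ³" => EuclideanSpace ℝ (Fin 3)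

/-! ### The smooth displacement profile and its amplitude -/

/-- The displacement profile `D(t) = D₀ · smoothTransition ((s₂ − t)/(s₂ − s₁))`: equal to `D₀` for
`t ≤ s₁`, to `0` for `t ≥ s₂`, smooth. -/
def cutoffDisp (D₀ s₁ s₂ : ℝ) (t : ℝ) : ℝ :=
  D₀ * Real.smoothTransition ((s₂ - t) / (s₂ - s₁))

/-- The amplitude `a = −D′` of the cut-off uniform drift `b(t, x) = a(t) e`. -/
def cutoffAmp (D₀ s₁ s₂ : ℝ) (t : ℝ) : ℝ :=
  -deriv (cutoffDisp D₀ s₁ s₂) t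

/-- The displacement profile is smooth. -/
theorem contDiff_cutoffDisp (D₀ s₁ s₂ : ℝ) : ContDiff ℝ ∞ (cutoffDisp D₀ s₁ s₂) := by
  have h1 : ContDiff ℝ ∞ (fun t : ℝ => (s₂ - t) / (s₂ - s₁)) := by
    have : (fun t : ℝ => (s₂ - t) / (s₂ - s₁)) = fun t => (s₂ - s₁)⁻¹ * (s₂ - t) := by
      funext t; rw [div_eq_inv_mul]
    rw [this]
    fun_prop
  exact contDiff_const.mul (Real.smoothTransition.contDiff.comp h1)

/-- The amplitude is smooth. -/
theorem contDiff_cutoffAmp (D₀ s₁ s₂ : ℝ) : ContDiff ℝ ∞ (cutoffAmp D₀ s₁ s₂) :=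
  (contDiff_infty_iff_deriv.1 (contDiff_cutoffDisp D₀ s₁ s₂)).2.neg

/-- `D = D₀` to the left of the transition. -/
theorem cutoffDisp_of_le_left {D₀ s₁ s₂ t : ℝ} (h12 : s₁ < s₂) (ht : t ≤ s₁) :
    cutoffDisp D₀ s₁ s₂ t = D₀ := by
  unfold cutoffDisp
  rw [Real.smoothTransition.one_of_one_le, mul_one]
  rw [le_div_iff₀ (sub_pos.2 h12)]
  linarith

/-- `D = 0` to the right of the transition. -/
theorem cutoffDisp_of_right_le {D₀ s₁ s₂ t : ℝ} (h12 : s₁ < s₂) (ht : s₂ ≤ t) :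
    cutoffDisp D₀ s₁ s₂ t = 0 := by
  unfold cutoffDisp
  rw [Real.smoothTransition.zero_of_nonpos, mul_zero]
  exact div_nonpos_of_nonpos_of_nonneg (by linarith) (sub_pos.2 h12).le

/-- `D² ≤ D₀²` everywhere (`0 ≤ smoothTransition ≤ 1`). -/
theorem sq_cutoffDisp_le (D₀ s₁ s₂ t : ℝ) : cutoffDisp D₀ s₁ s₂ t ^ 2 ≤ D₀ ^ 2 := by
  unfold cutoffDisp
  have h0 := Real.smoothTransition.nonneg ((s₂ - t) / (s₂ - s₁))
  have h1 := Real.smoothTransition.le_one ((s₂ - t) / (s₂ - s₁))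
  rw [mul_pow]
  nlinarith [sq_nonneg D₀, mul_le_one₀ h1 h0 h1]

/-- The amplitude vanishes to the left of the transition (`D` is locally constant there). -/
theorem cutoffAmp_of_lt_left {D₀ s₁ s₂ t : ℝ} (h12 : s₁ < s₂) (ht : t < s₁) :
    cutoffAmp D₀ s₁ s₂ t = 0 := by
  unfold cutoffAmp
  have h : cutoffDisp D₀ s₁ s₂ =ᶠ[𝓝 t] fun _ => D₀ := by
    filter_upwards [Iio_mem_nhds ht] with s hs
    exact cutoffDisp_of_le_left h12 (le_of_lt hs)
  rw [h.deriv_eq, deriv_const, neg_zero]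

/-- The amplitude vanishes to the right of the transition (`D` is locally zero there). -/
theorem cutoffAmp_of_right_lt {D₀ s₁ s₂ t : ℝ} (h12 : s₁ < s₂) (ht : s₂ < t) :
    cutoffAmp D₀ s₁ s₂ t = 0 := by
  unfold cutoffAmp
  have h : cutoffDisp D₀ s₁ s₂ =ᶠ[𝓝 t] fun _ => (0 : ℝ) := by
    filter_upwards [Ioi_mem_nhds ht] with s hs
    exact cutoffDisp_of_right_le h12 (le_of_lt hs)
  rw [h.deriv_eq, deriv_const, neg_zero]

/-- `D′ = −a` (by definition of the amplitude and smoothness of `D`). -/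
theorem hasDerivAt_cutoffDisp (D₀ s₁ s₂ t : ℝ) :
    HasDerivAt (cutoffDisp D₀ s₁ s₂) (-cutoffAmp D₀ s₁ s₂ t) t := by
  unfold cutoffAmp
  rw [neg_neg]
  exact (((contDiff_cutoffDisp D₀ s₁ s₂).differentiable (by simp)) t).hasDerivAt

/-- The amplitude is bounded (continuous, and zero off `[s₁, s₂]`). -/
theorem exists_bound_cutoffAmp (D₀ : ℝ) {s₁ s₂ : ℝ} (h12 : s₁ < s₂) :
    ∃ B : ℝ, ∀ t, |cutoffAmp D₀ s₁ s₂ t| ≤ B := by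
  obtain ⟨B, hB⟩ := (isCompact_Icc (a := s₁) (b := s₂)).exists_bound_of_continuousOn
    (contDiff_cutoffAmp D₀ s₁ s₂).continuous.continuousOn
  refine ⟨B, fun t => ?_⟩
  by_cases h : t ∈ Icc s₁ s₂
  · have := hB t h
    rwa [Real.norm_eq_abs] at this
  · have hB0 : 0 ≤ B := le_trans (norm_nonneg _) (hB s₁ ⟨le_rfl, h12.le⟩)
    rw [mem_Icc, not_and_or, not_le, not_le] at h
    rcases h with h | h
    · rw [cutoffAmp_of_lt_left h12 h, abs_zero]; exact hB0
    · rw [cutoffAmp_of_right_lt h12 h, abs_zero]; exact hB0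

/-! ### The stub's hypotheses hold on the family -/

/-- **All hypotheses of `stub_cauchyKernel` hold for the cut-off uniform drift** `b = a(t) e`,
`a = cutoffAmp D₀ s₁ s₂`, for every `tb`, every `tₘ < T` and every `s₁ < s₂ < T`: jointly smooth on
`Ico tb T`, divergence-free, bounded, and vanishing on `[T₁, T)` with `T₁ = (max s₂ tₘ + T)/2 ∈ (tₘ, T)`. -/
theorem cutoffUniform_cauchyStub_hypotheses {tₘ T s₁ s₂ : ℝ} (htₘ : tₘ < T) (h12 : s₁ < s₂)
    (hs₂ : s₂ < T) (tb D₀ : ℝ) (e : ℝ³) :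
    IsSmoothSpaceTimeOn (Ico tb T) (uniformVel (cutoffAmp D₀ s₁ s₂) e) ∧
    (∀ t ∈ Ico tb T, VectorCalculus.IsDivFree (uniformVel (cutoffAmp D₀ s₁ s₂) e t)) ∧
    (∃ B : ℝ, ∀ t ∈ Ico tb T, ∀ x, ‖uniformVel (cutoffAmp D₀ s₁ s₂) e t x‖ ≤ B) ∧
    (∃ T₁ ∈ Ioo tₘ T, ∀ t ∈ Ico T₁ T, ∀ x, uniformVel (cutoffAmp D₀ s₁ s₂) e t x = 0) := by
  refine ⟨?_, fun t _ => isDivFree_const _, ?_, ?_⟩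
  · have h : ContDiff ℝ ∞ (fun p : ℝ × ℝ³ => cutoffAmp D₀ s₁ s₂ p.1 • e) :=
      ((contDiff_cutoffAmp D₀ s₁ s₂).comp contDiff_fst).smul contDiff_const
    exact h.contDiffOn
  · obtain ⟨B, hB⟩ := exists_bound_cutoffAmp D₀ h12
    refine ⟨B * ‖e‖, fun t _ x => ?_⟩
    rw [uniformVel_apply, norm_smul, Real.norm_eq_abs]
    exact mul_le_mul_of_nonneg_right (hB t) (norm_nonneg e)
  · refine ⟨(max s₂ tₘ + T) / 2, ⟨?_, ?_⟩, fun t ht x => ?_⟩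
    · have := le_max_right s₂ tₘ
      linarith
    · have := max_lt hs₂ htₘ
      linarith
    · have hts : s₂ < t := by
        have h1 := le_max_left s₂ tₘ
        have h2 := max_lt hs₂ htₘ
        linarith [ht.1]
      rw [uniformVel_apply, cutoffAmp_of_right_lt h12 hts, zero_smul]

/-! ### The stub's conclusion holds on the family, with the explicit recentred kernel -/

/-- **The conclusion of `stub_cauchyKernel` holds for the cut-off uniform drift**, witnessed by the
recentred heat kernel `Γ(t, x) = G_{ν(T−t)}(x − x₀ + D(t) e)`: it is an adapted backward kernel of
`b = a(t) e` on `Ico tₘ T` with pole `(T, x₀)` (`isAdaptedBackwardKernel_recentred_Ico`: `D′ = −a`,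
`D → 0`), and it has the Gaussian envelope `K (T−t)^{-3/2} e^{−‖x−x₀‖²/(8ν(T−t))}`,
`K = (4πν)^{-3/2} e^{D₀²‖e‖²/(4ν(T−s₂))}`, on `Ioo tₘ T` (the pole is displaced by at most `|D₀|‖e‖`,
and only at times `t < s₂`, where `T − t > T − s₂`). -/
theorem cutoffUniform_cauchyStub_conclusion {ν tₘ T s₁ s₂ : ℝ} (hν : 0 < ν) (h12 : s₁ < s₂)
    (hs₂ : s₂ < T) (D₀ : ℝ) (e x₀ : ℝ³) :
    IsAdaptedBackwardKernel ν (uniformVel (cutoffAmp D₀ s₁ s₂) e) (Ico tₘ T) T x₀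
      (recentredKernel ν T x₀ e (cutoffDisp D₀ s₁ s₂)) ∧
    ∃ K a : ℝ, 0 < a ∧ ∀ t ∈ Ioo tₘ T, ∀ x,
      recentredKernel ν T x₀ e (cutoffDisp D₀ s₁ s₂) t x ≤
        K * (T - t) ^ (-(3:ℝ) / 2) * Real.exp (-(‖x - x₀‖ ^ 2) / (a * (T - t))) := by
  have hD2 : ContDiffOn ℝ 2 (cutoffDisp D₀ s₁ s₂) (Iio T) :=
    ((contDiff_cutoffDisp D₀ s₁ s₂).of_le (by norm_cast)).contDiffOn
  have hD : ∀ t < T, HasDerivAt (cutoffDisp D₀ s₁ s₂) (-cutoffAmp D₀ s₁ s₂ t) t :=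
    fun t _ => hasDerivAt_cutoffDisp D₀ s₁ s₂ t
  have hD0 : Tendsto (cutoffDisp D₀ s₁ s₂) (𝓝[<] T) (𝓝 0) := by
    refine (tendsto_const_nhds (x := (0 : ℝ))).congr' ?_
    filter_upwards [Ioo_mem_nhdsLT hs₂] with t ht
    exact (cutoffDisp_of_right_le h12 ht.1.le).symm
  refine ⟨isAdaptedBackwardKernel_recentred_Ico hν tₘ T x₀ e hD2 hD hD0,
    (4 * Real.pi * ν) ^ (-(3 : ℝ) / 2) * Real.exp (D₀ ^ 2 * ‖e‖ ^ 2 / (4 * ν * (T - s₂))), 8 * ν,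
    by positivity, fun t ht x => ?_⟩
  have hs : 0 < T - t := sub_pos.2 ht.2
  have hgap : 0 < T - s₂ := sub_pos.2 hs₂
  set s := T - t with hsdef
  set D := cutoffDisp D₀ s₁ s₂ t with hDdef
  rw [recentredKernel_closed_form hν.le x₀ e _ ht.2 x]
  -- the displaced pole costs at most `D² ‖e‖² / (4 ν s) ≤ D₀² ‖e‖² / (4 ν (T - s₂))`
  have hz : ‖x - x₀‖ ^ 2 ≤ 2 * ‖x - x₀ + D • e‖ ^ 2 + 2 * (D ^ 2 * ‖e‖ ^ 2) := by
    have h := norm_add_sq_le_two_mul (x - x₀ + D • e) (-(D • e))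
    rw [add_neg_cancel_right, norm_neg, norm_smul, mul_pow, Real.norm_eq_abs, sq_abs] at h
    exact h
  have hdisp : D ^ 2 * ‖e‖ ^ 2 / (4 * ν * s) ≤ D₀ ^ 2 * ‖e‖ ^ 2 / (4 * ν * (T - s₂)) := by
    by_cases hts : s₂ ≤ t
    · have hD0' : D = 0 := cutoffDisp_of_right_le h12 hts
      rw [hD0']
      simp only [ne_eq, OfNat.ofNat_ne_zero, not_false_eq_true, zero_pow, zero_mul, zero_div]
      positivity
    · push Not at hts
      have hle : T - s₂ ≤ s := by rw [hsdef]; linarith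
      have hnum : D ^ 2 * ‖e‖ ^ 2 ≤ D₀ ^ 2 * ‖e‖ ^ 2 :=
        mul_le_mul_of_nonneg_right (sq_cutoffDisp_le D₀ s₁ s₂ t) (sq_nonneg _)
      calc D ^ 2 * ‖e‖ ^ 2 / (4 * ν * s) ≤ D₀ ^ 2 * ‖e‖ ^ 2 / (4 * ν * s) :=
            div_le_div_of_nonneg_right hnum (by positivity)
        _ ≤ D₀ ^ 2 * ‖e‖ ^ 2 / (4 * ν * (T - s₂)) :=
            div_le_div_of_nonneg_left (by positivity) (by positivity)
              (mul_le_mul_of_nonneg_left hle (by positivity))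
  have hexp : -(‖x - x₀ + D • e‖ ^ 2) / (4 * ν * s) ≤
      D₀ ^ 2 * ‖e‖ ^ 2 / (4 * ν * (T - s₂)) + -(‖x - x₀‖ ^ 2) / (8 * ν * s) := by
    have h1 : -(‖x - x₀ + D • e‖ ^ 2) / (4 * ν * s) ≤
        D ^ 2 * ‖e‖ ^ 2 / (4 * ν * s) + -(‖x - x₀‖ ^ 2) / (8 * ν * s) := by
      rw [← sub_nonneg]
      have hkey : D ^ 2 * ‖e‖ ^ 2 / (4 * ν * s) + -(‖x - x₀‖ ^ 2) / (8 * ν * s) -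
          -(‖x - x₀ + D • e‖ ^ 2) / (4 * ν * s) =
          (2 * ‖x - x₀ + D • e‖ ^ 2 + 2 * (D ^ 2 * ‖e‖ ^ 2) - ‖x - x₀‖ ^ 2) / (8 * ν * s) := by
        field_simp
        ring
      rw [hkey]
      exact div_nonneg (by linarith [hz]) (by positivity)
    linarith [h1, hdisp]
  have := Real.exp_le_exp.2 hexp
  rw [Real.exp_add] at this
  calc (4 * Real.pi * ν) ^ (-(3 : ℝ) / 2) * s ^ (-(3 : ℝ) / 2) *
        Real.exp (-(‖x - x₀ + D • e‖ ^ 2) / (4 * ν * s))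
      ≤ (4 * Real.pi * ν) ^ (-(3 : ℝ) / 2) * s ^ (-(3 : ℝ) / 2) *
        (Real.exp (D₀ ^ 2 * ‖e‖ ^ 2 / (4 * ν * (T - s₂))) *
          Real.exp (-(‖x - x₀‖ ^ 2) / (8 * ν * s))) :=
        mul_le_mul_of_nonneg_left this (by positivity)
    _ = (4 * Real.pi * ν) ^ (-(3 : ℝ) / 2) * Real.exp (D₀ ^ 2 * ‖e‖ ^ 2 / (4 * ν * (T - s₂))) *
        s ^ (-(3 : ℝ) / 2) * Real.exp (-(‖x - x₀‖ ^ 2) / (8 * ν * s)) := by ring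
    _ = _ := by rw [show 8 * ν * s = (8 * ν) * s by ring]

/-- **The stub instantiated**: hypotheses AND conclusion of `stub_cauchyKernel` on the cut-off uniform
family, packaged in the stub's own shape (`∃ G, adapted ∧ ∃ K a, envelope`), for every `ν > 0`,
`tb`, `tₘ < T`, `s₁ < s₂ < T`, `D₀`, `e`, `x₀`. -/
theorem cutoffUniform_cauchyStub_instance {ν tₘ T s₁ s₂ : ℝ} (hν : 0 < ν) (htₘ : tₘ < T)
    (h12 : s₁ < s₂) (hs₂ : s₂ < T) (tb D₀ : ℝ) (e x₀ : ℝ³) :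
    (IsSmoothSpaceTimeOn (Ico tb T) (uniformVel (cutoffAmp D₀ s₁ s₂) e) ∧
      (∀ t ∈ Ico tb T, VectorCalculus.IsDivFree (uniformVel (cutoffAmp D₀ s₁ s₂) e t)) ∧
      (∃ B : ℝ, ∀ t ∈ Ico tb T, ∀ x, ‖uniformVel (cutoffAmp D₀ s₁ s₂) e t x‖ ≤ B) ∧
      (∃ T₁ ∈ Ioo tₘ T, ∀ t ∈ Ico T₁ T, ∀ x, uniformVel (cutoffAmp D₀ s₁ s₂) e t x = 0)) ∧
    ∃ G : ℝ → ℝ³ → ℝ,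
      IsAdaptedBackwardKernel ν (uniformVel (cutoffAmp D₀ s₁ s₂) e) (Ico tₘ T) T x₀ G ∧
      ∃ K a : ℝ, 0 < a ∧ ∀ t ∈ Ioo tₘ T, ∀ x,
        G t x ≤ K * (T - t) ^ (-(3:ℝ) / 2) * Real.exp (-(‖x - x₀‖ ^ 2) / (a * (T - t))) :=
  ⟨cutoffUniform_cauchyStub_hypotheses htₘ h12 hs₂ tb D₀ e,
    recentredKernel ν T x₀ e (cutoffDisp D₀ s₁ s₂), cutoffUniform_cauchyStub_conclusion hν h12 hs₂ D₀ e x₀⟩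

end Summit.NavierStokesRegularity.NavierStokesRegularity.Theorems.AdaptedKernelExistsNegative.CutoffUniform

end
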